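/-
Copyright (c) 2026 the pub-hodgecm-mathlib formalisation cell (harness21).  Prover seat hodgecm-mathlib-K2E3-p05 (g3), Track B «K2-LIT», engine E3, unit U4 «Keys»;
PLACE-FREE LAYER (`hd ↦ hϖ`, convention of ★ `F0P3cStCharTSStLevelsPF` ∕ ★ `F0P3cStCharTSStIwahoriFixedPF`); 2026-09-04.  KERNEL module: THEOREMS ONLY (no definition, no named fact, no
`sorry`, no instance, no notation).
-/
import Summits.HodgeConjecture.HodgeConjecture.Theorems.F0P3cStCharTSPSLevels            -- ★ PS-LEVELS (LH6-p03): the `hd`-free lemmas are imported (`inducingLine_eq_one_of_proj_mem`, `…_of_mem_integralLevel`, `lineFixedPoints_eq_bot_of_witness`, `finrank_…_K0`, `inducingLine_apply_torus`)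
import Summits.HodgeConjecture.HodgeConjecture.Theorems.F0P3cStCharTSStIwahoriFixedPF     -- ★ P2a PLACE-FREE: `valued_diag_le_one_of_mem_K1 (hϖ)`; brings ★ P1 `F0P3cStCharTSStLevelsPF` (`cover_borel_I ∕ disj_borel_I ∕ cover_borel_K1 ∕ mem_I_of_coe_eq_diagonal` over `hϖ`)
import HarnessLib

/-!
# K2 ∕ E3 «EllipticInputs», unit U4 «Keys» — Road II′ (TAME RAMIFIED places), PLACE-FREE LAYER PS-LEVELS-PF: the five datum-readers of ★ PS-LEVELS ∕ PS-LEVELS-CELLS over the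
# UNIFORMISER TOKEN `hϖ : |ϖ|_w = exp(−1)` alone — `dim i_G(χ)^{I} = 2·[U]`, `dim i_G(χ)^{K₁} = [U]` at EVERY non-split `v`, unramified OR ramified   [Borel1976 §4; Casselman1980 §3; Tits1979 §3.3.2]

Cell hodgecm-mathlib (D-0151), FLOOR 0, Track B «K2-LIT», engine E3, crux item H413 = stmt-HodgeConjecture-24833 (route `HCCMUnconditional`, no route verbs); target BY NAME
`…K2E3EllipticInputs.U4Keys.sig_K2E3KeysThmTwoContracting` (U4-f).  Author K2E3-p05 (g3).  `--supports stmt-HodgeConjecture-24833 --as helper`; THEOREMS ONLY.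
WHY.  The unramified rung of U4-f (★ p856959) runs Road II over the unramified datum `hd : UnramifiedLocalConjDatum σ_w ϖ` (`v` inert).  The residue (R1) of MEMO v4 — `v` RAMIFIED in
`L∕L⁺` — runs the SAME road: every II-brick reads `hd` only through `hd.σσ`, `hd.vσ`, `hd.vϖ` (`rg` over the II cone: 7 + 15 + 19 uses, nothing else), and `σ_w ∘ σ_w = id`,
`|σ_w ·|_w = |·|_w` are place-free theorems (★ `galAdicCompletionMap_galAdicCompletionMap_of_smul_eq`, ★ `valued_galAdicCompletionMap`).  This file is the first storey of the
place-free port of the II cone (the MACKEY binders are already place-free: ★ P1 `F0P3cStCharTSStLevelsPF`): ★ `F0P3cStCharTSPSLevelsCells.inducingLine_eq_one_of_mem_K1`,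
`mem_I_of_model_diagonal`, `torus_mem_cells` and ★ `F0P3cStCharTSPSLevels.finrank_fixedPoints_cmPrincipalSeries_I ∕ _K1`, statements with `hϖ` in place of `hd`, proofs VERBATIM
(re-lettered `hd.σσ ↦ ★`, `hd.vσ ↦ ★`, `hd.vϖ ↦ hϖ`, cross-file calls re-pointed to the ★ PF twins).  Valid at every non-split `v`: unramified (`σϖ = ϖ`) or ramified (`σϖ = −ϖ`).
HONEST LABEL: HC_CM is proved only modulo the 7 printed citations (2 remaining named inputs: hLiu418 = stmt-HodgeConjecture-24832, h413 = stmt-HodgeConjecture-24833)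
until rung 0 closes; count-neutral (place-free twin; the ★ files are NOT edited; no printed citation is discharged).

## References
* [Borel1976] A. Borel, Invent. Math. 35 (1976), §3–§4.  * [Casselman1980] W. Casselman, Compositio Math. 40 (1980), §3.  * [Tits1979] J. Tits, PSPM 33.1 (1979), §3.3.2, §3.5, §3.7.
* [BruhatTits1972] F. Bruhat, J. Tits, Publ. Math. IHÉS 41 (1972), (4.4.3)–(4.4.4).  * [Rogawski1990] J. D. Rogawski, Ann. of Math. Stud. 123 (1990), §4.5 p. 45, §12.1 p. 171.
-/

set_option autoImplicit false
-- the mandated namespace has the single-problem summit's repeated segment (`HodgeConjecture.HodgeConjecture`)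
set_option linter.dupNamespace false

noncomputable section

open NumberField IsDedekindDomain MeasureTheory
open scoped Matrix MatrixGroups NNReal WithZero
open Literature.NumberTheory.Automorphic Literature.NumberTheory.Automorphic.UnitaryGroup
open Literature.NumberTheory.Rogawski1990 Literature.NumberTheory.GaloisRepresentations

namespace Summit.HodgeConjecture.HodgeConjecture.Cruxes.H413.K2E3PSLevelsPF

open Summit.HodgeConjecture.HodgeConjecture.Cruxes.H413
open Summit.HodgeConjecture.HodgeConjecture.Cruxes.H413.F0P3cStCharTSStLevelsTransport
open Summit.HodgeConjecture.HodgeConjecture.Cruxes.H413.F0P3cStCharTSStIwahoriFixed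

variable (L : Type) [Field L] [NumberField L] [IsCMField L] (v : HeightOneSpectrum (𝓞 ↥(maximalRealSubfield L)))
  (w : PlacesOver L v) (hw : IsCMField.complexConj L • w.1 = w.1)
  (eA : Gqs L v ≃ₜ* ↥(unitaryGroupOfForm (galAdicCompletionMap (L := L) (IsCMField.complexConj L) hw) ((StdForm.antidiagonal 3).over (w.1.adicCompletion L))))
  (heA : ∀ g : Gqs L v,
    ((eA g : ↥(unitaryGroupOfForm (galAdicCompletionMap (L := L) (IsCMField.complexConj L) hw) ((StdForm.antidiagonal 3).over (w.1.adicCompletion L)))) : GL (Fin 3) (w.1.adicCompletion L)) =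
      ((localNonsplitEquiv (IsCMField.complexConj L) (qsForm L) (IsCMField.complexConj_ne_one L) w hw g :
        ↥(unitaryGroupOfForm (galAdicCompletionMap (L := L) (IsCMField.complexConj L) hw) (placeForm (qsForm L) w.1))) : GL (Fin 3) (w.1.adicCompletion L)))

/-! ## §1 Under `U`: the inducing line is trivial on `B ∩ K_v`, `B ∩ K1` -/

include heA in
set_option maxHeartbeats 1600000 in
-- instance-path unification between `Gqs L v` and the literal carrier of ★ `cmPrincipalSeries`
/-- **On `B ∩ K₁`** the inducing line of an unramified `χ` is trivial: the diagonal of `h ∈ B ∩ K₁` and of `h⁻¹ ∈ B ∩ K₁` is integral (FILE D `F0P3cStCharTSStIwahoriFixedPF.valued_diag_le_one_of_mem_K1`),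
so `proj h ∈ K_v` (★ `mem_cmLocalIntegralLevel_iff_forall_v_le_one`, ★ `val_proj_borelTriple`, `val_proj_inv_borelTriple`); `K₁` is compact (FILE C).
[cite: Tits1979, §3.3.2] [cite: Rogawski1990, §4.5 p. 45] -/
theorem inducingLine_eq_one_of_mem_K1 {ϖ : w.1.adicCompletion L}
    (hϖ : Valued.v ϖ = WithZero.exp (-1 : ℤ))
    (g₁ : GL (Fin 3) (w.1.adicCompletion L)) (hg₁ : (g₁ : Matrix (Fin 3) (Fin 3) (w.1.adicCompletion L)) = Matrix.diagonal ![(1 : w.1.adicCompletion L), 1, ϖ])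
    (K0 K1 I : Subgroup (Gqs L v))
    (hK0 : K0 = ((glInt 3 (w.1.adicCompletion L)).subgroupOf
      (unitaryGroupOfForm (galAdicCompletionMap (L := L) (IsCMField.complexConj L) hw) ((StdForm.antidiagonal 3).over (w.1.adicCompletion L)))).comap
        eA.toMulEquiv.toMonoidHom)
    (hK1 : K1 = (((glInt 3 (w.1.adicCompletion L)).map (MulAut.conj g₁).toMonoidHom).subgroupOf
      (unitaryGroupOfForm (galAdicCompletionMap (L := L) (IsCMField.complexConj L) hw) ((StdForm.antidiagonal 3).over (w.1.adicCompletion L)))).comap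
        eA.toMulEquiv.toMonoidHom)
    (hI : I = K0 ⊓ K1)
    (χ : ↥(torusU (conjLocal L (IsCMField.complexConj L) v) (cmLocalForm L 3 v)) →* ℂˣ)
    (hU : ∀ t : ↥(torusU (conjLocal L (IsCMField.complexConj L) v) (cmLocalForm L 3 v)),
      (t : ↥(unitaryGroupOfForm (conjLocal L (IsCMField.complexConj L) v) (cmLocalForm L 3 v))) ∈ cmLocalIntegralLevel L 3 (qsForm L) v → χ t = 1)
    (h : ↥(cmBorelTriple L 3 v).P) (hh : (h : ↥(unitaryGroupOfForm (conjLocal L (IsCMField.complexConj L) v) (cmLocalForm L 3 v))) ∈ K1) :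
    haveI := locallyCompactSpace_cmBorelU L 3 v
    (Representation.twist
      (((Representation.trivial ℂ ↥(torusU (conjLocal L (IsCMField.complexConj L) v) (cmLocalForm L 3 v)) ℂ).twist χ).comp (cmBorelTriple L 3 v).proj)
      (rootDeltaChar (cmBorelTriple L 3 v).P)) h = 1 := by
  haveI : Subsingleton (PlacesOver L v) := PlacesOver.subsingleton_of_smul_eq (IsCMField.complexConj L) (IsCMField.complexConj_ne_one L) w hw
  have hK1c := (isOpen_isCompact_levels L v w hw eA g₁ K0 K1 I hK0 hK1 hI).2.1.2
  have hK1sub : ∀ x : ↥(unitaryGroupOfForm (conjLocal L (IsCMField.complexConj L) v) (cmLocalForm L 3 v)), x ∈ K1 → x⁻¹ ∈ K1 := fun x hx => K1.inv_mem hx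
  have hhinv : ((h⁻¹ : ↥(cmBorelTriple L 3 v).P) : ↥(unitaryGroupOfForm (conjLocal L (IsCMField.complexConj L) v) (cmLocalForm L 3 v))) ∈ K1 := hK1sub _ hh
  refine F0P3cStCharTSPSLevelsCells.inducingLine_eq_one_of_proj_mem L v χ hU (K := K1) hK1c h hh ?_
  refine (mem_cmLocalIntegralLevel_iff_forall_v_le_one L 3 v _).2 ⟨fun i j w' => ?_, fun i j w' => ?_⟩
  · obtain rfl : w' = w := Subsingleton.elim _ _
    rw [val_proj_borelTriple, Matrix.diagonal_apply]
    split_ifs with hij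
    · exact F0P3cStCharTSStIwahoriFixedPF.valued_diag_le_one_of_mem_K1 L v w' hw eA heA hϖ g₁ hg₁ K1 hK1 _ hh i
    · rw [Pi.zero_apply, map_zero]; exact zero_le
  · obtain rfl : w' = w := Subsingleton.elim _ _
    rw [val_proj_inv_borelTriple, Matrix.diagonal_apply]
    split_ifs with hij
    · exact F0P3cStCharTSStIwahoriFixedPF.valued_diag_le_one_of_mem_K1 L v w' hw eA heA hϖ g₁ hg₁ K1 hK1 _ hhinv i
    · rw [Pi.zero_apply, map_zero]; exact zero_le

/-! ## §2 Under `¬U`: the witness `t ∈ T ∩ K_v`, `χ t ≠ 1`, and the cells it lies in -/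

/-- **A diagonal element of `G_v` whose model matrix is `diag(e)` with `|eᵢ|_w = 1` lies in the Iwahori level `I = K0 ⊓ K1`** (★ Iwahori test
`mem_glInt_inf_conj_glInt_iff`: integral entries, the three lower entries `0 ∈ 𝔭`).  The general form of FILE C `F0P3cStCharTSStLevelsPF.mem_I_of_coe_eq_diagonal`.
[cite: Tits1979, §3.7] [cite: BruhatTits1972, (4.4.4)] -/
theorem mem_I_of_model_diagonal {ϖ : w.1.adicCompletion L}
    (hϖ : Valued.v ϖ = WithZero.exp (-1 : ℤ))
    (g₁ : GL (Fin 3) (w.1.adicCompletion L)) (hg₁ : (g₁ : Matrix (Fin 3) (Fin 3) (w.1.adicCompletion L)) = Matrix.diagonal ![(1 : w.1.adicCompletion L), 1, ϖ])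
    (K0 K1 I : Subgroup (Gqs L v))
    (hK0 : K0 = ((glInt 3 (w.1.adicCompletion L)).subgroupOf
      (unitaryGroupOfForm (galAdicCompletionMap (L := L) (IsCMField.complexConj L) hw) ((StdForm.antidiagonal 3).over (w.1.adicCompletion L)))).comap
        eA.toMulEquiv.toMonoidHom)
    (hK1 : K1 = (((glInt 3 (w.1.adicCompletion L)).map (MulAut.conj g₁).toMonoidHom).subgroupOf
      (unitaryGroupOfForm (galAdicCompletionMap (L := L) (IsCMField.complexConj L) hw) ((StdForm.antidiagonal 3).over (w.1.adicCompletion L)))).comap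
        eA.toMulEquiv.toMonoidHom)
    (hI : I = K0 ⊓ K1)
    (g : Gqs L v) (e : Fin 3 → w.1.adicCompletion L) (he : ∀ i, Valued.v (e i) = 1)
    (hg : (((eA g : ↥(unitaryGroupOfForm (galAdicCompletionMap (L := L) (IsCMField.complexConj L) hw)
      ((StdForm.antidiagonal 3).over (w.1.adicCompletion L)))) : GL (Fin 3) (w.1.adicCompletion L)) : Matrix (Fin 3) (Fin 3) (w.1.adicCompletion L)) =
        Matrix.diagonal e) :
    g ∈ I := by
  subst hI hK0 hK1
  rw [Subgroup.mem_inf, Subgroup.mem_comap, Subgroup.mem_comap]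
  change eA g ∈ (glInt 3 (w.1.adicCompletion L)).subgroupOf _ ∧ eA g ∈ ((glInt 3 (w.1.adicCompletion L)).map (MulAut.conj g₁).toMonoidHom).subgroupOf _
  rw [← Subgroup.mem_inf, mem_glInt_inf_conj_glInt_iff (galAdicCompletionMap (L := L) (IsCMField.complexConj L) hw) rfl (fun a => valued_galAdicCompletionMap (L := L) (IsCMField.complexConj L) hw a) hϖ g₁ hg₁, hg]
  refine ⟨fun i j => ?_, ?_, ?_, ?_⟩
  · rw [Matrix.diagonal_apply]
    split_ifs with hij
    · exact (he i).le
    · rw [map_zero]; exact zero_le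
  · rw [Matrix.diagonal_apply_ne _ (by decide), map_zero]; exact zero_lt_one
  · rw [Matrix.diagonal_apply_ne _ (by decide), map_zero]; exact zero_lt_one
  · rw [Matrix.diagonal_apply_ne _ (by decide), map_zero]; exact zero_lt_one

set_option maxHeartbeats 400000 in
include heA in
/-- **The witness in the cells**: a torus element `t ∈ T ∩ K_v` lies in `K0`, in `I`, and `w̃⁻¹ t w̃ ∈ I` (`w̃ = eA⁻¹ w`): its model matrix is `diag(tᵢᵢ(w))` with unit entries
(★ `v_torusEntry_eq_one_of_mem_cmLocalIntegralLevel`), and `w (eA t) w = diag` of the reversed entries (★ `coe_weylLongU_mul_mul_weylLongU_apply'`).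
[cite: Tits1979, §3.5, §3.7] [cite: Rogawski1990, §1.10 p. 9; §4.5 p. 45] -/
theorem torus_mem_cells {ϖ : w.1.adicCompletion L}
    (hϖ : Valued.v ϖ = WithZero.exp (-1 : ℤ))
    (g₁ : GL (Fin 3) (w.1.adicCompletion L)) (hg₁ : (g₁ : Matrix (Fin 3) (Fin 3) (w.1.adicCompletion L)) = Matrix.diagonal ![(1 : w.1.adicCompletion L), 1, ϖ])
    (K0 K1 I : Subgroup (Gqs L v))
    (hK0 : K0 = ((glInt 3 (w.1.adicCompletion L)).subgroupOf
      (unitaryGroupOfForm (galAdicCompletionMap (L := L) (IsCMField.complexConj L) hw) ((StdForm.antidiagonal 3).over (w.1.adicCompletion L)))).comap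
        eA.toMulEquiv.toMonoidHom)
    (hK1 : K1 = (((glInt 3 (w.1.adicCompletion L)).map (MulAut.conj g₁).toMonoidHom).subgroupOf
      (unitaryGroupOfForm (galAdicCompletionMap (L := L) (IsCMField.complexConj L) hw) ((StdForm.antidiagonal 3).over (w.1.adicCompletion L)))).comap
        eA.toMulEquiv.toMonoidHom)
    (hI : I = K0 ⊓ K1)
    (t : ↥(torusU (conjLocal L (IsCMField.complexConj L) v) (cmLocalForm L 3 v)))
    (ht : (t : ↥(unitaryGroupOfForm (conjLocal L (IsCMField.complexConj L) v) (cmLocalForm L 3 v))) ∈ cmLocalIntegralLevel L 3 (qsForm L) v) :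
    (t : ↥(unitaryGroupOfForm (conjLocal L (IsCMField.complexConj L) v) (cmLocalForm L 3 v))) ∈ K0 ∧
    (∀ i : Fin 2, (![(1 : ↥(unitaryGroupOfForm (conjLocal L (IsCMField.complexConj L) v) (cmLocalForm L 3 v))), eA.symm (weylLongU (galAdicCompletionMap (L := L) (IsCMField.complexConj L) hw) (rfl : (StdForm.antidiagonal 3).over (w.1.adicCompletion L) = _))] i)⁻¹ *
        (t : ↥(unitaryGroupOfForm (conjLocal L (IsCMField.complexConj L) v) (cmLocalForm L 3 v))) *
        (![(1 : ↥(unitaryGroupOfForm (conjLocal L (IsCMField.complexConj L) v) (cmLocalForm L 3 v))), eA.symm (weylLongU (galAdicCompletionMap (L := L) (IsCMField.complexConj L) hw) (rfl : (StdForm.antidiagonal 3).over (w.1.adicCompletion L) = _))] i) ∈ I) := by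
  have hK0mem : (t : ↥(unitaryGroupOfForm (conjLocal L (IsCMField.complexConj L) v) (cmLocalForm L 3 v))) ∈ K0 :=
    (mem_K0_iff_mem_integralLevel L v w hw eA heA K0 hK0 _).2 ht
  refine ⟨hK0mem, fun i => ?_⟩
  -- the model matrix of `eA t`: `diag(tᵢᵢ(w))`, unit entries
  obtain ⟨d, hdt⟩ := (mem_torusU_iff _).1 t.2
  have htmat : ((t : ↥(unitaryGroupOfForm (conjLocal L (IsCMField.complexConj L) v) (cmLocalForm L 3 v))).val.val : Matrix (Fin 3) (Fin 3) (LocalRing L v)) =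
      Matrix.diagonal fun k => ((d k : (LocalRing L v)ˣ) : LocalRing L v) := by
    have htval : (t : ↥(unitaryGroupOfForm (conjLocal L (IsCMField.complexConj L) v) (cmLocalForm L 3 v))).val = glDiagonal 3 (LocalRing L v) d := hdt.symm
    rw [htval, coe_glDiagonal]
  have hunit : ∀ k, Valued.v (((d k : (LocalRing L v)ˣ) : LocalRing L v) w) = 1 := fun k => by
    rw [← torusEntry_eq_of_glDiagonal_eq (conjLocal L (IsCMField.complexConj L) v) (cmLocalForm L 3 v) k t d hdt]
    exact v_torusEntry_eq_one_of_mem_cmLocalIntegralLevel L 3 v t ht k w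
  have hte : (((eA (t : ↥(unitaryGroupOfForm (conjLocal L (IsCMField.complexConj L) v) (cmLocalForm L 3 v))) : ↥(unitaryGroupOfForm (galAdicCompletionMap (L := L) (IsCMField.complexConj L) hw) ((StdForm.antidiagonal 3).over (w.1.adicCompletion L)))) : GL (Fin 3) (w.1.adicCompletion L)) : Matrix (Fin 3) (Fin 3) (w.1.adicCompletion L)) =
      Matrix.diagonal fun k => ((d k : (LocalRing L v)ˣ) : LocalRing L v) w := by
    refine Matrix.ext fun a b => ?_
    rw [coe_eA_apply L v w hw eA heA _ a b, htmat, Matrix.diagonal_apply, Matrix.diagonal_apply]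
    split_ifs with hab
    · rfl
    · rfl
  fin_cases i
  · -- cell `1`: `t ∈ I`
    have heq : (![(1 : ↥(unitaryGroupOfForm (conjLocal L (IsCMField.complexConj L) v) (cmLocalForm L 3 v))), eA.symm (weylLongU (galAdicCompletionMap (L := L) (IsCMField.complexConj L) hw) (rfl : (StdForm.antidiagonal 3).over (w.1.adicCompletion L) = _))] (0 : Fin 2))⁻¹ *
        (t : ↥(unitaryGroupOfForm (conjLocal L (IsCMField.complexConj L) v) (cmLocalForm L 3 v))) *
        (![(1 : ↥(unitaryGroupOfForm (conjLocal L (IsCMField.complexConj L) v) (cmLocalForm L 3 v))), eA.symm (weylLongU (galAdicCompletionMap (L := L) (IsCMField.complexConj L) hw) (rfl : (StdForm.antidiagonal 3).over (w.1.adicCompletion L) = _))] (0 : Fin 2)) = t := by simp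
    simp only [Fin.zero_eta]
    rw [heq]
    exact mem_I_of_model_diagonal L v w hw eA hϖ g₁ hg₁ K0 K1 I hK0 hK1 hI _ _ hunit hte
  · -- cell `w̃`: `w̃⁻¹ t w̃ ∈ I`, model matrix `w (eA t) w = diag` of the reversed entries
    let eU : ↥(unitaryGroupOfForm (conjLocal L (IsCMField.complexConj L) v) (cmLocalForm L 3 v)) ≃ₜ* ↥(unitaryGroupOfForm (galAdicCompletionMap (L := L) (IsCMField.complexConj L) hw) ((StdForm.antidiagonal 3).over (w.1.adicCompletion L))) := eA
    have hww : (weylLongU (galAdicCompletionMap (L := L) (IsCMField.complexConj L) hw) (rfl : (StdForm.antidiagonal 3).over (w.1.adicCompletion L) = _)) * (weylLongU (galAdicCompletionMap (L := L) (IsCMField.complexConj L) hw) (rfl : (StdForm.antidiagonal 3).over (w.1.adicCompletion L) = _)) = 1 := by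
      apply Subtype.ext; rw [Subgroup.coe_mul, coe_weylLongU, Subgroup.coe_one]; exact weylLong_mul_self 3 _
    have hwinv : (weylLongU (galAdicCompletionMap (L := L) (IsCMField.complexConj L) hw) (rfl : (StdForm.antidiagonal 3).over (w.1.adicCompletion L) = _))⁻¹ = (weylLongU (galAdicCompletionMap (L := L) (IsCMField.complexConj L) hw) (rfl : (StdForm.antidiagonal 3).over (w.1.adicCompletion L) = _)) := inv_eq_of_mul_eq_one_right hww
    have hmodel : eU ((![(1 : ↥(unitaryGroupOfForm (conjLocal L (IsCMField.complexConj L) v) (cmLocalForm L 3 v))), eA.symm (weylLongU (galAdicCompletionMap (L := L) (IsCMField.complexConj L) hw) (rfl : (StdForm.antidiagonal 3).over (w.1.adicCompletion L) = _))] (1 : Fin 2))⁻¹ * (t : ↥(unitaryGroupOfForm (conjLocal L (IsCMField.complexConj L) v) (cmLocalForm L 3 v))) * (![(1 : ↥(unitaryGroupOfForm (conjLocal L (IsCMField.complexConj L) v) (cmLocalForm L 3 v))), eA.symm (weylLongU (galAdicCompletionMap (L := L) (IsCMField.complexConj L) hw) (rfl : (StdForm.antidiagonal 3).over (w.1.adicCompletion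 L) = _))] (1 : Fin 2))) = (weylLongU (galAdicCompletionMap (L := L) (IsCMField.complexConj L) hw) (rfl : (StdForm.antidiagonal 3).over (w.1.adicCompletion L) = _)) * eU (t : ↥(unitaryGroupOfForm (conjLocal L (IsCMField.complexConj L) v) (cmLocalForm L 3 v))) * (weylLongU (galAdicCompletionMap (L := L) (IsCMField.complexConj L) hw) (rfl : (StdForm.antidiagonal 3).over (w.1.adicCompletion L) = _)) := by
      rw [map_mul, map_mul, map_inv, eA_vec L v w hw eA 1]
      simp only [Matrix.cons_val_one, Matrix.cons_val_fin_one]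
      rw [hwinv]
    refine mem_I_of_model_diagonal L v w hw eA hϖ g₁ hg₁ K0 K1 I hK0 hK1 hI _ (fun k => ((d (Fin.rev k) : (LocalRing L v)ˣ) : LocalRing L v) w)
      (fun k => hunit (Fin.rev k)) ?_
    change (((eU ((![(1 : ↥(unitaryGroupOfForm (conjLocal L (IsCMField.complexConj L) v) (cmLocalForm L 3 v))), eA.symm (weylLongU (galAdicCompletionMap (L := L) (IsCMField.complexConj L) hw) (rfl : (StdForm.antidiagonal 3).over (w.1.adicCompletion L) = _))] (1 : Fin 2))⁻¹ * (t : ↥(unitaryGroupOfForm (conjLocal L (IsCMField.complexConj L) v) (cmLocalForm L 3 v))) * (![(1 : ↥(unitaryGroupOfForm (conjLocal L (IsCMField.complexConj L) v) (cmLocalForm L 3 v))), eA.symm (weylLongU (galAdicCompletionMap (L := L) (IsCMField.complexConj L) hw) (rfl : (StdForm.antidiagonal 3).over (w.1.adicCompletion L) = _))] (1 : Fin 2))) : ↥(unitaryGroupOfForm (galAdicCompletionMap (L := L) (IsCMField.complexConj L) hw) ((StdForm.antidiagonal 3).over (w.1.adicCompletion L)))) : GL (Fin 3) (w.1.adicCompletion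 L)) : Matrix (Fin 3) (Fin 3) (w.1.adicCompletion L)) = _
    rw [hmodel]
    have hte' : (((eU (t : ↥(unitaryGroupOfForm (conjLocal L (IsCMField.complexConj L) v) (cmLocalForm L 3 v))) : ↥(unitaryGroupOfForm (galAdicCompletionMap (L := L) (IsCMField.complexConj L) hw) ((StdForm.antidiagonal 3).over (w.1.adicCompletion L)))) : GL (Fin 3) (w.1.adicCompletion L)) : Matrix (Fin 3) (Fin 3) (w.1.adicCompletion L)) =
        Matrix.diagonal fun k => ((d k : (LocalRing L v)ˣ) : LocalRing L v) w := hte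
    refine Matrix.ext fun a b => ?_
    rw [coe_weylLongU_mul_mul_weylLongU_apply', hte', Matrix.diagonal_apply, Matrix.diagonal_apply]
    by_cases hab : a = b
    · subst hab; simp
    · rw [if_neg (fun h => hab (Fin.rev_injective h)), if_neg hab]


/-! ## §3 The three counts -/

include heA in
open Classical in
set_option maxHeartbeats 1600000 in
set_option synthInstance.maxHeartbeats 400000 in
-- instance-path unification between `Gqs L v` and the literal carrier of ★ `cmPrincipalSeries`
/-- **`dim i_G(χ)^{I} = 2·[U]`** (MACKEY ★ `finrank_fixedPoints_smoothIndRep_eq_card_filter` over `G_v = B·I ⊔ B·w̃·I`, FILE C): under `U` both cells are alive (their `B ∩ gIg⁻¹`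
lie in `K0 = K_v`, §1); under `¬U` the witness `t` lies in `I` and `w̃⁻¹ t w̃ ∈ I` (§2) and kills both.  The general form of FILE D `finrank_fixedPoints_cmPrincipalSeries_stChar_I`.
[cite: Borel1976, §3–§4] [cite: Casselman1995, Prop. 1.3.1, §3] [cite: BruhatTits1972, (4.4.4)] -/
theorem finrank_fixedPoints_cmPrincipalSeries_I {ϖ : w.1.adicCompletion L}
    (hϖ : Valued.v ϖ = WithZero.exp (-1 : ℤ))
    (g₁ : GL (Fin 3) (w.1.adicCompletion L)) (hg₁ : (g₁ : Matrix (Fin 3) (Fin 3) (w.1.adicCompletion L)) = Matrix.diagonal ![(1 : w.1.adicCompletion L), 1, ϖ])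
    (K0 K1 I : Subgroup (Gqs L v))
    (hK0 : K0 = ((glInt 3 (w.1.adicCompletion L)).subgroupOf
      (unitaryGroupOfForm (galAdicCompletionMap (L := L) (IsCMField.complexConj L) hw) ((StdForm.antidiagonal 3).over (w.1.adicCompletion L)))).comap
        eA.toMulEquiv.toMonoidHom)
    (hK1 : K1 = (((glInt 3 (w.1.adicCompletion L)).map (MulAut.conj g₁).toMonoidHom).subgroupOf
      (unitaryGroupOfForm (galAdicCompletionMap (L := L) (IsCMField.complexConj L) hw) ((StdForm.antidiagonal 3).over (w.1.adicCompletion L)))).comap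
        eA.toMulEquiv.toMonoidHom)
    (hI : I = K0 ⊓ K1)
    (χ : ↥(torusU (conjLocal L (IsCMField.complexConj L) v) (cmLocalForm L 3 v)) →* ℂˣ) :
    Module.finrank ℂ ((cmPrincipalSeries L 3 v χ).fixedPoints I) = if (∀ t : ↥(torusU (conjLocal L (IsCMField.complexConj L) v) (cmLocalForm L 3 v)), (t : ↥(unitaryGroupOfForm (conjLocal L (IsCMField.complexConj L) v) (cmLocalForm L 3 v))) ∈ cmLocalIntegralLevel L 3 (qsForm L) v → χ t = 1) then 2 else 0 := by
  haveI := locallyCompactSpace_cmBorelU L 3 v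
  have hIo' := (isOpen_isCompact_levels L v w hw eA g₁ K0 K1 I hK0 hK1 hI).2.2.1
  have hIo : @IsOpen ↥(unitaryGroupOfForm (conjLocal L (IsCMField.complexConj L) v) (cmLocalForm L 3 v)) inferInstance (I : Set (Gqs L v)) := hIo'
  have hM := Representation.finrank_fixedPoints_smoothIndRep_eq_card_filter (Representation.twist
      (((Representation.trivial ℂ ↥(torusU (conjLocal L (IsCMField.complexConj L) v) (cmLocalForm L 3 v)) ℂ).twist χ).comp (cmBorelTriple L 3 v).proj)
      (rootDeltaChar (cmBorelTriple L 3 v).P)) hIo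
    (F0P3cStCharTSStLevelsPF.cover_borel_I L v w hw eA heA hϖ g₁ hg₁ K0 K1 I hK0 hK1 hI) (F0P3cStCharTSStLevelsPF.disj_borel_I L v w hw eA heA hϖ g₁ hg₁ K0 K1 I hK0 hK1 hI) (Module.finrank_self ℂ)
  refine hM.trans ?_
  have mulK0 : ∀ x y : ↥(unitaryGroupOfForm (conjLocal L (IsCMField.complexConj L) v) (cmLocalForm L 3 v)), x ∈ K0 → y ∈ K0 → x * y ∈ K0 := fun x y hx hy => K0.mul_mem hx hy
  have invK0 : ∀ x : ↥(unitaryGroupOfForm (conjLocal L (IsCMField.complexConj L) v) (cmLocalForm L 3 v)), x ∈ K0 → x⁻¹ ∈ K0 := fun x hx => K0.inv_mem hx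
  have hw0 : (![(1 : ↥(unitaryGroupOfForm (conjLocal L (IsCMField.complexConj L) v) (cmLocalForm L 3 v))), eA.symm (weylLongU (galAdicCompletionMap (L := L) (IsCMField.complexConj L) hw) (rfl : (StdForm.antidiagonal 3).over (w.1.adicCompletion L) = _))] 1) ∈ K0 := eA_symm_weylLongU_mem_K0 L v w hw eA K0 hK0
  have hIK0 : ∀ x : ↥(unitaryGroupOfForm (conjLocal L (IsCMField.complexConj L) v) (cmLocalForm L 3 v)), x ∈ I → x ∈ K0 := fun x hx => I_le_K0 L v K0 K1 I hI hx
  by_cases hU : (∀ t : ↥(torusU (conjLocal L (IsCMField.complexConj L) v) (cmLocalForm L 3 v)), (t : ↥(unitaryGroupOfForm (conjLocal L (IsCMField.complexConj L) v) (cmLocalForm L 3 v))) ∈ cmLocalIntegralLevel L 3 (qsForm L) v → χ t = 1)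
  · rw [if_pos hU, Finset.filter_true_of_mem, Finset.card_univ, Fintype.card_fin]
    intro i _ h hmem
    have hmem' : (![(1 : ↥(unitaryGroupOfForm (conjLocal L (IsCMField.complexConj L) v) (cmLocalForm L 3 v))), eA.symm (weylLongU (galAdicCompletionMap (L := L) (IsCMField.complexConj L) hw) (rfl : (StdForm.antidiagonal 3).over (w.1.adicCompletion L) = _))] i)⁻¹ * (h : ↥(unitaryGroupOfForm (conjLocal L (IsCMField.complexConj L) v) (cmLocalForm L 3 v))) * (![(1 : ↥(unitaryGroupOfForm (conjLocal L (IsCMField.complexConj L) v) (cmLocalForm L 3 v))), eA.symm (weylLongU (galAdicCompletionMap (L := L) (IsCMField.complexConj L) hw) (rfl : (StdForm.antidiagonal 3).over (w.1.adicCompletion L) = _))] i) ∈ I := hmem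
    have hhK0 : (h : ↥(unitaryGroupOfForm (conjLocal L (IsCMField.complexConj L) v) (cmLocalForm L 3 v))) ∈ K0 := by
      fin_cases i
      · have heq : (![(1 : ↥(unitaryGroupOfForm (conjLocal L (IsCMField.complexConj L) v) (cmLocalForm L 3 v))), eA.symm (weylLongU (galAdicCompletionMap (L := L) (IsCMField.complexConj L) hw) (rfl : (StdForm.antidiagonal 3).over (w.1.adicCompletion L) = _))] (0 : Fin 2))⁻¹ * (h : ↥(unitaryGroupOfForm (conjLocal L (IsCMField.complexConj L) v) (cmLocalForm L 3 v))) * (![(1 : ↥(unitaryGroupOfForm (conjLocal L (IsCMField.complexConj L) v) (cmLocalForm L 3 v))), eA.symm (weylLongU (galAdicCompletionMap (L := L) (IsCMField.complexConj L) hw) (rfl : (StdForm.antidiagonal 3).over (w.1.adicCompletion L) = _))] (0 : Fin 2)) = h := by simp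
        have h' : (![(1 : ↥(unitaryGroupOfForm (conjLocal L (IsCMField.complexConj L) v) (cmLocalForm L 3 v))), eA.symm (weylLongU (galAdicCompletionMap (L := L) (IsCMField.complexConj L) hw) (rfl : (StdForm.antidiagonal 3).over (w.1.adicCompletion L) = _))] (0 : Fin 2))⁻¹ * (h : ↥(unitaryGroupOfForm (conjLocal L (IsCMField.complexConj L) v) (cmLocalForm L 3 v))) * (![(1 : ↥(unitaryGroupOfForm (conjLocal L (IsCMField.complexConj L) v) (cmLocalForm L 3 v))), eA.symm (weylLongU (galAdicCompletionMap (L := L) (IsCMField.complexConj L) hw) (rfl : (StdForm.antidiagonal 3).over (w.1.adicCompletion L) = _))] (0 : Fin 2)) ∈ I := hmem'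
        rw [heq] at h'
        exact hIK0 _ h'
      · have h' : (![(1 : ↥(unitaryGroupOfForm (conjLocal L (IsCMField.complexConj L) v) (cmLocalForm L 3 v))), eA.symm (weylLongU (galAdicCompletionMap (L := L) (IsCMField.complexConj L) hw) (rfl : (StdForm.antidiagonal 3).over (w.1.adicCompletion L) = _))] (1 : Fin 2))⁻¹ * (h : ↥(unitaryGroupOfForm (conjLocal L (IsCMField.complexConj L) v) (cmLocalForm L 3 v))) * (![(1 : ↥(unitaryGroupOfForm (conjLocal L (IsCMField.complexConj L) v) (cmLocalForm L 3 v))), eA.symm (weylLongU (galAdicCompletionMap (L := L) (IsCMField.complexConj L) hw) (rfl : (StdForm.antidiagonal 3).over (w.1.adicCompletion L) = _))] (1 : Fin 2)) ∈ I := hmem'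
        have hprod := mulK0 _ _ (mulK0 _ _ hw0 (hIK0 _ h')) (invK0 _ hw0)
        have heq : (![(1 : ↥(unitaryGroupOfForm (conjLocal L (IsCMField.complexConj L) v) (cmLocalForm L 3 v))), eA.symm (weylLongU (galAdicCompletionMap (L := L) (IsCMField.complexConj L) hw) (rfl : (StdForm.antidiagonal 3).over (w.1.adicCompletion L) = _))] (1 : Fin 2)) * ((![(1 : ↥(unitaryGroupOfForm (conjLocal L (IsCMField.complexConj L) v) (cmLocalForm L 3 v))), eA.symm (weylLongU (galAdicCompletionMap (L := L) (IsCMField.complexConj L) hw) (rfl : (StdForm.antidiagonal 3).over (w.1.adicCompletion L) = _))] (1 : Fin 2))⁻¹ * (h : ↥(unitaryGroupOfForm (conjLocal L (IsCMField.complexConj L) v) (cmLocalForm L 3 v))) * (![(1 : ↥(unitaryGroupOfForm (conjLocal L (IsCMField.complexConj L) v) (cmLocalForm L 3 v))), eA.symm (weylLongU (galAdicCompletionMap (L := L) (IsCMField.complexConj L) hw) (rfl : (StdForm.antidiagonal 3).over (w.1.adicCompletion L) = _))] (1 : Fin 2))) * (![(1 : ↥(unitaryGroupOfForm (conjLocal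 L (IsCMField.complexConj L) v) (cmLocalForm L 3 v))), eA.symm (weylLongU (galAdicCompletionMap (L := L) (IsCMField.complexConj L) hw) (rfl : (StdForm.antidiagonal 3).over (w.1.adicCompletion L) = _))] (1 : Fin 2))⁻¹ = h := by group
        rw [heq] at hprod
        exact hprod
    exact F0P3cStCharTSPSLevelsCells.inducingLine_eq_one_of_mem_integralLevel L v χ hU h ((mem_K0_iff_mem_integralLevel L v w hw eA heA K0 hK0 _).1 hhK0)
  · rw [if_neg hU, Finset.card_eq_zero, Finset.filter_eq_empty_iff]
    push Not at hU
    obtain ⟨t, ht, hχt⟩ := hU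
    obtain ⟨-, hcells⟩ := torus_mem_cells L v w hw eA heA hϖ g₁ hg₁ K0 K1 I hK0 hK1 hI t ht
    intro i _ hall
    have htB : ((t : ↥(unitaryGroupOfForm (conjLocal L (IsCMField.complexConj L) v) (cmLocalForm L 3 v))) ∈ (cmBorelTriple L 3 v).P) := torusU_le_borelU _ _ t.2
    have h1p := hall ⟨_, htB⟩ (hcells i)
    rw [F0P3cStCharTSPSLevelsCells.inducingLine_apply_torus L v χ t ht] at h1p
    have h11 := LinearMap.congr_fun h1p (1 : ℂ)
    rw [LinearMap.smul_apply, Module.End.one_apply, smul_eq_mul, mul_one] at h11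
    exact hχt (Units.val_eq_one.1 h11)

include heA in
open Classical in
set_option maxHeartbeats 1600000 in
set_option synthInstance.maxHeartbeats 400000 in
-- instance-path unification between `Gqs L v` and the literal carrier of ★ `cmPrincipalSeries`
/-- **`dim i_G(χ)^{K1} = [U]`** (MACKEY over `G_v = B·K₁`, FILE C `F0P3cStCharTSStLevelsPF.cover_borel_K1`; §1 `inducingLine_eq_one_of_mem_K1`; the witness of §2 lies in `I ≤ K₁`).  The general form of FILE D
`finrank_fixedPoints_cmPrincipalSeries_stChar_K1`. [cite: Borel1976, §3–§4] [cite: Casselman1995, Prop. 1.3.1, §3] [cite: Tits1979, §3.3.2] -/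
theorem finrank_fixedPoints_cmPrincipalSeries_K1 {ϖ : w.1.adicCompletion L}
    (hϖ : Valued.v ϖ = WithZero.exp (-1 : ℤ))
    (g₁ : GL (Fin 3) (w.1.adicCompletion L)) (hg₁ : (g₁ : Matrix (Fin 3) (Fin 3) (w.1.adicCompletion L)) = Matrix.diagonal ![(1 : w.1.adicCompletion L), 1, ϖ])
    (K0 K1 I : Subgroup (Gqs L v))
    (hK0 : K0 = ((glInt 3 (w.1.adicCompletion L)).subgroupOf
      (unitaryGroupOfForm (galAdicCompletionMap (L := L) (IsCMField.complexConj L) hw) ((StdForm.antidiagonal 3).over (w.1.adicCompletion L)))).comap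
        eA.toMulEquiv.toMonoidHom)
    (hK1 : K1 = (((glInt 3 (w.1.adicCompletion L)).map (MulAut.conj g₁).toMonoidHom).subgroupOf
      (unitaryGroupOfForm (galAdicCompletionMap (L := L) (IsCMField.complexConj L) hw) ((StdForm.antidiagonal 3).over (w.1.adicCompletion L)))).comap
        eA.toMulEquiv.toMonoidHom)
    (hI : I = K0 ⊓ K1)
    (χ : ↥(torusU (conjLocal L (IsCMField.complexConj L) v) (cmLocalForm L 3 v)) →* ℂˣ) :
    Module.finrank ℂ ((cmPrincipalSeries L 3 v χ).fixedPoints K1) = if (∀ t : ↥(torusU (conjLocal L (IsCMField.complexConj L) v) (cmLocalForm L 3 v)), (t : ↥(unitaryGroupOfForm (conjLocal L (IsCMField.complexConj L) v) (cmLocalForm L 3 v))) ∈ cmLocalIntegralLevel L 3 (qsForm L) v → χ t = 1) then 1 else 0 := by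
  haveI := locallyCompactSpace_cmBorelU L 3 v
  have hK1o' := (isOpen_isCompact_levels L v w hw eA g₁ K0 K1 I hK0 hK1 hI).2.1.1
  have hK1o : @IsOpen ↥(unitaryGroupOfForm (conjLocal L (IsCMField.complexConj L) v) (cmLocalForm L 3 v)) inferInstance (K1 : Set (Gqs L v)) := hK1o'
  have hdisj : ∀ i j : Unit, (∃ h : ↥(cmBorelTriple L 3 v).P, ∃ κ : ↥(unitaryGroupOfForm (conjLocal L (IsCMField.complexConj L) v) (cmLocalForm L 3 v)), κ ∈ K1 ∧
      (fun _ : Unit => (1 : ↥(unitaryGroupOfForm (conjLocal L (IsCMField.complexConj L) v) (cmLocalForm L 3 v)))) j = (h : ↥(unitaryGroupOfForm (conjLocal L (IsCMField.complexConj L) v) (cmLocalForm L 3 v))) * (fun _ : Unit => (1 : ↥(unitaryGroupOfForm (conjLocal L (IsCMField.complexConj L) v) (cmLocalForm L 3 v)))) i * κ) → i = j := fun _ _ _ => Subsingleton.elim _ _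
  have hM := Representation.finrank_fixedPoints_smoothIndRep_eq_card_filter (Representation.twist
      (((Representation.trivial ℂ ↥(torusU (conjLocal L (IsCMField.complexConj L) v) (cmLocalForm L 3 v)) ℂ).twist χ).comp (cmBorelTriple L 3 v).proj)
      (rootDeltaChar (cmBorelTriple L 3 v).P)) hK1o
    (F0P3cStCharTSStLevelsPF.cover_borel_K1 L v w hw eA heA hϖ g₁ hg₁ K1 hK1) hdisj (Module.finrank_self ℂ)
  refine hM.trans ?_
  by_cases hU : (∀ t : ↥(torusU (conjLocal L (IsCMField.complexConj L) v) (cmLocalForm L 3 v)), (t : ↥(unitaryGroupOfForm (conjLocal L (IsCMField.complexConj L) v) (cmLocalForm L 3 v))) ∈ cmLocalIntegralLevel L 3 (qsForm L) v → χ t = 1)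
  · rw [if_pos hU, Finset.filter_true_of_mem, Finset.card_univ, Fintype.card_unit]
    intro i _ h hmem
    have hmem' : (1 : ↥(unitaryGroupOfForm (conjLocal L (IsCMField.complexConj L) v) (cmLocalForm L 3 v)))⁻¹ * (h : ↥(unitaryGroupOfForm (conjLocal L (IsCMField.complexConj L) v) (cmLocalForm L 3 v))) * 1 ∈ K1 := hmem
    rw [inv_one, one_mul, mul_one] at hmem'
    exact inducingLine_eq_one_of_mem_K1 L v w hw eA heA hϖ g₁ hg₁ K0 K1 I hK0 hK1 hI χ hU h hmem'
  · rw [if_neg hU, Finset.card_eq_zero, Finset.filter_eq_empty_iff]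
    push Not at hU
    obtain ⟨t, ht, hχt⟩ := hU
    obtain ⟨-, hcells⟩ := torus_mem_cells L v w hw eA heA hϖ g₁ hg₁ K0 K1 I hK0 hK1 hI t ht
    intro i _ hall
    have htB : ((t : ↥(unitaryGroupOfForm (conjLocal L (IsCMField.complexConj L) v) (cmLocalForm L 3 v))) ∈ (cmBorelTriple L 3 v).P) := torusU_le_borelU _ _ t.2
    have hconj : (1 : ↥(unitaryGroupOfForm (conjLocal L (IsCMField.complexConj L) v) (cmLocalForm L 3 v)))⁻¹ * (t : ↥(unitaryGroupOfForm (conjLocal L (IsCMField.complexConj L) v) (cmLocalForm L 3 v))) * 1 ∈ K1 := by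
      rw [inv_one, one_mul, mul_one]
      have h0 := hcells 0
      have heq : (![(1 : ↥(unitaryGroupOfForm (conjLocal L (IsCMField.complexConj L) v) (cmLocalForm L 3 v))), eA.symm (weylLongU (galAdicCompletionMap (L := L) (IsCMField.complexConj L) hw) (rfl : (StdForm.antidiagonal 3).over (w.1.adicCompletion L) = _))] (0 : Fin 2))⁻¹ * (t : ↥(unitaryGroupOfForm (conjLocal L (IsCMField.complexConj L) v) (cmLocalForm L 3 v))) * (![(1 : ↥(unitaryGroupOfForm (conjLocal L (IsCMField.complexConj L) v) (cmLocalForm L 3 v))), eA.symm (weylLongU (galAdicCompletionMap (L := L) (IsCMField.complexConj L) hw) (rfl : (StdForm.antidiagonal 3).over (w.1.adicCompletion L) = _))] (0 : Fin 2)) = t := by simp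
      rw [heq] at h0
      exact I_le_K1 L v K0 K1 I hI h0
    have h1p := hall ⟨_, htB⟩ hconj
    rw [F0P3cStCharTSPSLevelsCells.inducingLine_apply_torus L v χ t ht] at h1p
    have h11 := LinearMap.congr_fun h1p (1 : ℂ)
    rw [LinearMap.smul_apply, Module.End.one_apply, smul_eq_mul, mul_one] at h11
    exact hχt (Units.val_eq_one.1 h11)


end Summit.HodgeConjecture.HodgeConjecture.Cruxes.H413.K2E3PSLevelsPF

end
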